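import Summits.BirchSwinnertonDyer.Rank1Residual.Additive.ZpTowerPlaceCount
import Literature.NumberTheory.EllipticCurves.ZpExtensionUnramifiedProofs
import Mathlib.NumberTheory.RamificationInertia.Galois
import HarnessLib

/-!
# A place `v ∤ p` is UNRAMIFIED in every layer of a `ℤ_p`-extension: `e(v, K_n/K) = 1` in
# Mathlib's `Ideal.ramificationIdxIn` currency
# (cell `b2b-bsdres`, team n1011, seat p06 GEN 4; OWNERS row T-E3g-ADD, FILE G — the `he` binder of
# `Additive/AdditiveTamagawaWitnessBaseChange.lean` at the layers `K_n = κ.layer n`)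

HONEST FRAMING (cell `b2b-bsdres`, run/shared/lean/b2b/bsd-rank1-residual/, verbatim in every
file): the goal of the cell is to DELETE the COMBINATION-SHAPED residual classes of the
Birch–Swinnerton-Dyer formula for ALL analytic-rank `≤ 1` elliptic curves over `ℚ` — "full BSD
formula for every rank `≤ 1` curve in class `C`" assembled STRICTLY from published theorems — so
that the rank-`≤ 1` remainder becomes exactly the CONSTRUCTION-SHAPED classes, which are TYPED
(missing-input `Prop`s), NOT attempted. This is not "finishing BSD". Team n1011 (N10/N11: X4 ∧
`p = 3`): research routes on CONSTRUCTION-SHAPED classes; nothing is booked by this file.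
THEOREMS ONLY: no definition, no named fact, nothing asserted.

## What (rows T-E3g-ADD FILE F / T-E3g-BUDn N2; Washington Prop. 13.2 in `ramificationIdxIn` form)

The layer form of the additive (and of the split-multiplicative) Tamagawa witness is stated for a
finite Galois extension `M/K` and a place `w ∣ v` with `he : v.asIdeal.ramificationIdxIn (𝓞 M) = 1`
(the currency of additive-p2's `Additive.hasAdditiveReductionAt_baseChange_of_ramificationIdxIn_eq_one`).
At `M = K_n = κ.layer n`, the `n`-th layer of a `ℤ_p`-extension `κ` of the number field `K`, and
`v ∤ p`, THIS FILE discharges `he`: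

  `ZpTower.ramificationIdxIn_layer_eq_one (κ) (n) (hv : (p : 𝓞 K) ∉ v.asIdeal) :
      v.asIdeal.ramificationIdxIn (𝓞 (κ.layer n)) = 1`.

Proof (no class field theory; counting): the inertia group `I_𝔓 ≤ Γ_K` of a prime `𝔓 ∣ v` of
`\bar ℤ_K` lies in `ker κ` (the tree's `ZpExtension.inertia_le_kerSubgroup_holds`, Washington 13.2 /
Lang Ch. 5 §1 along the local structure of inertia), hence in `Gal(K̄/K_n) = κ⁻¹(pⁿℤ_p)`
(`range_absGaloisRestrict_layer`); so the tree's "unramified" place count applies: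
`#{w ∣ v} · ord(Frob) = [K_n : K]` with `f(w|v) = ord(Frob)` for every `w ∣ v`
(`card_placesOver_mul_orderOf_eq_finrank`, `inertiaDeg_eq_orderOf`); comparing with Mathlib's
fundamental identity for the Galois extension `K_n/K`, `g · e · f = [K_n : K]`
(`Ideal.ncard_primesOver_mul_ramificationIdxIn_mul_inertiaDegIn`, `g = #{w ∣ v}`,
`f = f(w|v)`), gives `e = 1`.

References: L. C. Washington, *Introduction to Cyclotomic Fields* (1997), Prop. 13.2
[Washington1997]; S. Lang, *Cyclotomic Fields I and II* (1990), Ch. 5 §1 Lemma (i) [Lang1990];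
J. Neukirch, *Algebraic Number Theory* (1999), Ch. I §9 Prop. (9.4), Ch. II §9 [NeukirchANT1999].
-/

set_option autoImplicit false

noncomputable section

open scoped Classical NumberField Pointwise

open IsDedekindDomain Field NumberField Literature.NumberTheory.GaloisRepresentations
  Literature.NumberTheory.EllipticCurves

namespace Summit.BirchSwinnertonDyer.Rank1Residual.Additive.ZpTower

/-! ### Places above `v` versus Mathlib's `primesOver` -/

section Places

variable {K : Type} {F : Type} [Field K] [NumberField K] [Field F] [NumberField F] [Algebra K F]

omit [NumberField K] [NumberField F] in
/-- The finite places of `F` above a finite place `v` of `K` are in bijection with Mathlib's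
`primesOver v.asIdeal (𝓞 F)` (a prime over the nonzero `v` is nonzero). [folklore] -/
theorem natCard_placesOver_eq_ncard_primesOver (v : HeightOneSpectrum (𝓞 K)) :
    Nat.card {w : HeightOneSpectrum (𝓞 F) // w.under (𝓞 K) = v} =
      (v.asIdeal.primesOver (𝓞 F)).ncard := by
  rw [← Nat.card_coe_set_eq]
  refine Nat.card_congr
    { toFun := fun w ↦ ⟨w.1.asIdeal, w.1.isPrime, ⟨(congrArg HeightOneSpectrum.asIdeal w.2).symm⟩⟩
      invFun := fun P ↦ ⟨⟨P.1, P.2.1, by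
          haveI := P.2.2
          exact Ideal.ne_bot_of_liesOver_of_ne_bot v.ne_bot P.1⟩,
        HeightOneSpectrum.ext (by
          haveI := P.2.2
          change (HeightOneSpectrum.mk P.1 P.2.1 _).asIdeal.under (𝓞 K) = v.asIdeal
          exact (Ideal.LiesOver.over (p := v.asIdeal) (P := P.1)).symm)⟩
      left_inv := fun w ↦ rfl
      right_inv := fun P ↦ rfl }

end Places

/-! ### `e(v, K_n/K) = 1` for `v ∤ p` -/

section Layer

variable {K : Type} [Field K] [NumberField K] {p : ℕ} [Fact p.Prime] (κ : ZpExtension K p) (n : ℕ)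

/-- **A `ℤ_p`-extension is unramified outside `p`, layer by layer, in `ramificationIdxIn` form**
(Washington, Prop. 13.2): for a number field `K`, a `ℤ_p`-extension `κ`, a layer `K_n = κ.layer n`
and a finite place `v ∤ p` of `K`, `e(v, K_n/K) = v.asIdeal.ramificationIdxIn (𝓞 K_n) = 1`.
(`I_𝔓 ≤ ker κ ≤ Gal(K̄/K_n)`, the unramified place count `#{w ∣ v} · ord(Frob) = [K_n : K]` of the
tree, and Mathlib's `g · e · f = [K_n : K]`.) This is the binder `he` of
`exists_mem_unramifiedSubgroup_not_mem_kummerLocalConditionAt_baseChange_of_dvd_localTamagawaNumber`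
at `M = K_n`. [cite: Washington1997, Prop. 13.2] [cite: NeukirchANT1999, Ch. I §9 Prop. (9.4)] -/
theorem ramificationIdxIn_layer_eq_one {v : HeightOneSpectrum (𝓞 K)}
    (hv : ((p : ℕ) : 𝓞 K) ∉ v.asIdeal) :
    v.asIdeal.ramificationIdxIn (𝓞 (κ.layer n)) = 1 := by
  classical
  haveI : Fintype {w : HeightOneSpectrum (𝓞 (κ.layer n)) // w.under (𝓞 K) = v} :=
    @Fintype.ofFinite _ (finite_heightOneSpectrum_under_eq v)
  obtain ⟨𝔓, h𝔓⟩ := v.primesAbove_nonempty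
  obtain ⟨σ, hσ⟩ := HeightOneSpectrum.exists_isArithFrobAt_of_mem_primesAbove_holds h𝔓
  have hrange := range_absGaloisRestrict_layer κ n
  have hN : (absGaloisRestrict K (κ.layer n)).toMonoidHom.range.Normal := by
    rw [hrange]; infer_instance
  have hI : 𝔓.inertia (absoluteGaloisGroup K) ≤
      (absGaloisRestrict K (κ.layer n)).toMonoidHom.range := by
    rw [hrange]
    exact (ZpExtension.inertia_le_kerSubgroup_holds K p κ hv h𝔓).trans
      (κ.kerSubgroup_le_layerSubgroup n)
  -- (1) the tree's unramified place count: `#W · ord = [K_n : K]`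
  have h1 := card_placesOver_mul_orderOf_eq_finrank K hN h𝔓 hI hσ
  -- (2) Mathlib's fundamental identity: `g · (e · f) = [K_n : K]`
  have h2 := Ideal.ncard_primesOver_mul_ramificationIdxIn_mul_inertiaDegIn v.asIdeal
    (𝓞 (κ.layer n)) ((κ.layer n) ≃ₐ[K] (κ.layer n))
  rw [IsGalois.card_aut_eq_finrank] at h2
  -- `g = #W`
  have hg : (v.asIdeal.primesOver (𝓞 (κ.layer n))).ncard =
      Fintype.card {w : HeightOneSpectrum (𝓞 (κ.layer n)) // w.under (𝓞 K) = v} := by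
    rw [← natCard_placesOver_eq_ncard_primesOver, Nat.card_eq_fintype_card]
  -- `#W ≠ 0`, and a place `w₀ ∣ v`
  have hfin : 0 < Module.finrank K (κ.layer n) := Module.finrank_pos
  have hW : 0 < Fintype.card {w : HeightOneSpectrum (𝓞 (κ.layer n)) // w.under (𝓞 K) = v} := by
    by_contra h0
    rw [not_lt, Nat.le_zero] at h0
    rw [h0, zero_mul] at h1
    omega
  obtain ⟨w₀⟩ := Fintype.card_pos_iff.mp hW
  -- `f = f(w₀|v) = ord`
  haveI : w₀.1.asIdeal.LiesOver v.asIdeal :=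
    ⟨(congrArg HeightOneSpectrum.asIdeal w₀.2).symm⟩
  have hf : v.asIdeal.inertiaDegIn (𝓞 (κ.layer n)) =
      orderOf (σ : absoluteGaloisGroup K ⧸ (absGaloisRestrict K (κ.layer n)).toMonoidHom.range) := by
    rw [Ideal.inertiaDegIn_eq_inertiaDeg v.asIdeal w₀.1.asIdeal ((κ.layer n) ≃ₐ[K] (κ.layer n))]
    exact inertiaDeg_eq_orderOf K hN h𝔓 hI hσ w₀.1 w₀.2
  -- compare (1) and (2): `#W * (e * ord) = #W * ord`, `#W ≠ 0`, `ord ≠ 0`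
  rw [hg, hf, ← h1] at h2
  have hord : 0 < orderOf (σ : absoluteGaloisGroup K ⧸
      (absGaloisRestrict K (κ.layer n)).toMonoidHom.range) := by
    by_contra h0
    rw [not_lt, Nat.le_zero] at h0
    rw [h0, mul_zero] at h1
    omega
  have h4 : v.asIdeal.ramificationIdxIn (𝓞 (κ.layer n)) *
      orderOf (σ : absoluteGaloisGroup K ⧸ (absGaloisRestrict K (κ.layer n)).toMonoidHom.range) =
      1 * orderOf (σ : absoluteGaloisGroup K ⧸
        (absGaloisRestrict K (κ.layer n)).toMonoidHom.range) := by
    rw [one_mul]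
    exact Nat.eq_of_mul_eq_mul_left hW h2
  exact Nat.eq_of_mul_eq_mul_right hord h4

end Layer

end Summit.BirchSwinnertonDyer.Rank1Residual.Additive.ZpTower

end
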